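import Literature.MathematicalPhysics.QuantumLattice.HubbardTTPrimeFreeSandwichBoxWords
import Literature.MathematicalPhysics.QuantumLattice.HubbardTTPrimeBoxTransport
import HarnessLib

/-!
# The `t'`-sliver of a sandwich box word at the KINEMATIC price `16/π²`

Family `hubbard` (topic `MathematicalPhysics/QuantumLattice`; a two-theorem companion of `HubbardTTPrimeFreeSandwichBoxWords`
§4 and hubbard-box-p3's `HubbardTTPrimeBoxTransport`). Written for stage S2 «points → BOXES» of the Hubbard material-oracle
programme (crew hubbard-fast, seat hubbard-box-p2, 2026-08-27).

The kernel free-gas floor rows (`HubbardFermiSeaCellRows` adapter) need `|t'| ≤ 1/2` (band monotone in the cosines); some router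
boxes reach beyond (Hg1201 object E: `t'/t_eff ∈ [−0.54, −0.43]`; the particle–hole images of the electron-doped boxes NCCO / SLCO:
`t' ∈ [0.51, 0.65]`). `HubbardTTPrimeFreeSandwichBoxWords.energyDensityTT'_floor_Icc₃_tPrime_extend` carries a floor over such a
sliver at the price `4·n₂` per unit of `t'`; the one-body constant `16/π² < 1.6212` of
`energyDensityTT'_tPrime_transport_ge_decimal` (`|K₂(ω)| ≤ 16/π²` for every torus-limit state) is `2.2×` cheaper at `n ≈ 0.9`.

* `energyDensityTT'_floor_Icc₃_tPrime_extend_kinematic`: floor `F` on `Set.Icc ![U₁,s₁,n₁] ![U₂,s₂,n₂]` ⇒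
  `F − 1.6212·max δ δ'` on the `t'`-range `[s₁ − δ, s₂ + δ']` (`δ ≥ 0`).
* `energyDensityTT'_cap_Icc₃_tPrime_extend_kinematic`: the cap twin (`C + 1.6212·max δ δ'`).

Everything is PROVED; no definition, no named fact, no number beyond the decimal `1.6212 > 16/π²` of the cited lemma.

## References

* R. B. Israel, *Convexity in the Theory of Lattice Gases* (1979), Thm. I.3.4. [cite: Israel1979, Thm. I.3.4]
* E. H. Lieb, M. Loss, Duke Math. J. 71 (1993) 337, §8 Thm. 8.2 (the `16/π²` one-body bound). [cite: LiebLoss1993, §8, Theorem 8.2]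
-/

namespace Literature.MathematicalPhysics.QuantumLattice.ThermodynamicLimit

open Literature.Probability.LatticeModels

/-- Distance from a point of `[s₁ − δ, s₂ + δ']` to its clamp into `[s₁, s₂]` is at most `max δ δ'`. [folklore] -/
private theorem abs_sub_clamp_le_max {s₁ s₂ δ δ' x : ℝ} (hs : s₁ ≤ s₂) (hδ : 0 ≤ δ)
    (h1 : s₁ - δ ≤ x) (h2 : x ≤ s₂ + δ') : |x - max s₁ (min x s₂)| ≤ max δ δ' := by
  rw [abs_le]
  rcases le_total x s₂ with hx2 | hx2
  · rw [min_eq_left hx2]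
    rcases le_total s₁ x with hx1 | hx1
    · rw [max_eq_right hx1]; constructor <;> linarith [le_max_left δ δ']
    · rw [max_eq_left hx1]; constructor <;> linarith [le_max_left δ δ']
  · rw [min_eq_right hx2, max_eq_right hs]
    constructor <;> linarith [le_max_left δ δ', le_max_right δ δ']

/-- **Floor word on a `t'`-extended box, kinematic price `1.6212 > 16/π²` per unit of `t'`.** A floor `F` on
`Set.Icc ![U₁, s₁, n₁] ![U₂, s₂, n₂]` (`0 ≤ U₁`, `s₁ ≤ s₂`, `0 ≤ n₁`, `n₂ < 2`) gives `F − 1.6212·max δ δ'` on the box with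
`t'`-range `[s₁ − δ, s₂ + δ']`, `δ ≥ 0` (clamp `θ 1` into `[s₁, s₂]`, read the floor there, transport by
`energyDensityTT'_tPrime_transport_ge_decimal`). [cite: Israel1979, Thm. I.3.4] [cite: LiebLoss1993, §8, Theorem 8.2] -/
theorem energyDensityTT'_floor_Icc₃_tPrime_extend_kinematic (t : ℝ) {U₁ U₂ s₁ s₂ n₁ n₂ F δ δ' : ℝ}
    (hU₁ : 0 ≤ U₁) (hs : s₁ ≤ s₂) (hn₁ : 0 ≤ n₁) (hn₂ : n₂ < 2) (hδ : 0 ≤ δ)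
    (hF : ∀ θ ∈ Set.Icc (![U₁, s₁, n₁] : Fin 3 → ℝ) ![U₂, s₂, n₂], F ≤ energyDensityTT' t (θ 1) (θ 0) (θ 2)) :
    ∀ θ ∈ Set.Icc (![U₁, s₁ - δ, n₁] : Fin 3 → ℝ) ![U₂, s₂ + δ', n₂],
      F - 1.6212 * max δ δ' ≤ energyDensityTT' t (θ 1) (θ 0) (θ 2) := by
  intro θ hθ
  obtain ⟨⟨k1, k2⟩, ⟨k3, k4⟩, ⟨k5, k6⟩⟩ := mem_Icc_vec3_iff.1 hθ
  set s : ℝ := max s₁ (min (θ 1) s₂) with hs_def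
  have hs₁' : s₁ ≤ s := le_max_left _ _
  have hs₂' : s ≤ s₂ := max_le hs (min_le_right _ _)
  have hmem : (![θ 0, s, θ 2] : Fin 3 → ℝ) ∈ Set.Icc (![U₁, s₁, n₁] : Fin 3 → ℝ) ![U₂, s₂, n₂] :=
    mem_Icc_vec3_iff.2 ⟨⟨by simpa using k1, by simpa using k2⟩, ⟨by simpa using hs₁', by simpa using hs₂'⟩,
      ⟨by simpa using k5, by simpa using k6⟩⟩
  have h1 : F ≤ energyDensityTT' t s (θ 0) (θ 2) := by simpa using hF _ hmem
  have h2 := energyDensityTT'_tPrime_transport_ge_decimal t (hU₁.trans k1) (hn₁.trans k5)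
    (lt_of_le_of_lt k6 hn₂) s (θ 1)
  have hd : |θ 1 - s| ≤ max δ δ' := abs_sub_clamp_le_max hs hδ k3 k4
  have h3 : 1.6212 * |θ 1 - s| ≤ 1.6212 * max δ δ' := mul_le_mul_of_nonneg_left hd (by norm_num)
  linarith

/-- **Cap word on a `t'`-extended box, kinematic price**: a cap `C` on `Set.Icc ![U₁, s₁, n₁] ![U₂, s₂, n₂]` gives
`C + 1.6212·max δ δ'` on the `t'`-range `[s₁ − δ, s₂ + δ']` (`δ ≥ 0`). [cite: Israel1979, Thm. I.3.4] [cite: LiebLoss1993, §8, Theorem 8.2] -/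
theorem energyDensityTT'_cap_Icc₃_tPrime_extend_kinematic (t : ℝ) {U₁ U₂ s₁ s₂ n₁ n₂ C δ δ' : ℝ}
    (hU₁ : 0 ≤ U₁) (hs : s₁ ≤ s₂) (hn₁ : 0 ≤ n₁) (hn₂ : n₂ < 2) (hδ : 0 ≤ δ)
    (hC : ∀ θ ∈ Set.Icc (![U₁, s₁, n₁] : Fin 3 → ℝ) ![U₂, s₂, n₂], energyDensityTT' t (θ 1) (θ 0) (θ 2) ≤ C) :
    ∀ θ ∈ Set.Icc (![U₁, s₁ - δ, n₁] : Fin 3 → ℝ) ![U₂, s₂ + δ', n₂],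
      energyDensityTT' t (θ 1) (θ 0) (θ 2) ≤ C + 1.6212 * max δ δ' := by
  intro θ hθ
  obtain ⟨⟨k1, k2⟩, ⟨k3, k4⟩, ⟨k5, k6⟩⟩ := mem_Icc_vec3_iff.1 hθ
  set s : ℝ := max s₁ (min (θ 1) s₂) with hs_def
  have hs₁' : s₁ ≤ s := le_max_left _ _
  have hs₂' : s ≤ s₂ := max_le hs (min_le_right _ _)
  have hmem : (![θ 0, s, θ 2] : Fin 3 → ℝ) ∈ Set.Icc (![U₁, s₁, n₁] : Fin 3 → ℝ) ![U₂, s₂, n₂] :=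
    mem_Icc_vec3_iff.2 ⟨⟨by simpa using k1, by simpa using k2⟩, ⟨by simpa using hs₁', by simpa using hs₂'⟩,
      ⟨by simpa using k5, by simpa using k6⟩⟩
  have h1 : energyDensityTT' t s (θ 0) (θ 2) ≤ C := by simpa using hC _ hmem
  -- transport from `θ 1` to `s`: `e(θ 1) - 1.6212 |s - θ 1| ≤ e(s)`
  have h2 := energyDensityTT'_tPrime_transport_ge_decimal t (hU₁.trans k1) (hn₁.trans k5)
    (lt_of_le_of_lt k6 hn₂) (θ 1) s
  have hd : |s - θ 1| ≤ max δ δ' := by rw [abs_sub_comm]; exact abs_sub_clamp_le_max hs hδ k3 k4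
  have h3 : 1.6212 * |s - θ 1| ≤ 1.6212 * max δ δ' := mul_le_mul_of_nonneg_left hd (by norm_num)
  linarith

end Literature.MathematicalPhysics.QuantumLattice.ThermodynamicLimit
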